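import Summits.CriticalPhenomena.PercolationContinuityZ3.Theorems.Transplant.Bcc111SKFinalM3
import Summits.CriticalPhenomena.PercolationContinuityZ3.Theorems.Transplant.Bcc111SKFinalM4
import Summits.CriticalPhenomena.PercolationContinuityZ3.Theorems.Transplant.Bcc111Route5
import Summits.CriticalPhenomena.PercolationContinuityZ3.Theorems.Transplant.Bcc111FilmCritical
import HarnessLib

/-!
# **THE bcc (111)-FILM ROW IS COMPLETE: `θ_{F_m(bcc)}(v, p_c(F_m(bcc))) = 0` FOR EVERY THICKNESS `m ≥ 1` AND EVERY VERTEX** — unconditional, p205010-free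

builds on p205010 (kernel theorem, internal audit signed; external expert review pending) — NOT used in this file, nor anywhere in this row.
Lane `prim-bschramm`, seat `prim-bschramm-p2` (gen 49; class C1b = films / other 3D lattices at their own critical point, METHOD = input substitution; memo
`HOME/bschramm/P2-LATTICES.md` §160); helper file (`--supports stmt-CriticalPhenomena-4575 --as helper`).

THE ROW.  `F_m(bcc) = bcc ∩ {0 ≤ x₀ + x₁ + x₂ ≤ m}` («Bcc111FilmHexShadow».`Bcc111.film m`), Bernoulli bond percolation at the film's own critical point:
* `m = 1, 2` — the honeycomb and the dice lattice: injective hexagonal shadow («Bcc111FilmCritical».`theta_criticalProb_eq_zero_of_le_two`);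
* `m = 3, 4` — Duminil-Copin–Sidoravicius–Tassion through the hexagonal shadow with the exit-form routing certificate `ShapedLinkageX 3` given by EXPLICIT
  kernel-checked swap-pair plans («Bcc111SKDefs» … «Bcc111SKCase», 39 + 39 case certificates «Bcc111SKc3··»/«Bcc111SKc4··», «Bcc111SKFinalM3/M4»);
* `m ≥ 5` — the same transplant with the certificate discharged uniformly by the `K_{2,3}` elevator-hub template and the kernel-checked planar claw table
  («Bcc111Route5».`theta_criticalProb_eq_zero_of_five_le`).
(`m = 0` is the edgeless triangular layer: bcc has no bond inside a level.)
* **`Bcc111.theta_criticalProb_eq_zero_of_one_le (hm : 1 ≤ m) (v) : θ_{F_m(bcc)}(v, p_c(F_m(bcc), v)) = 0`**, and the family form `theta_criticalProb_eq_zero_family`.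
[cite: DuminilCopinSidoraviciusTassion2016, Thm. 1 and §2] [cite: BenjaminiSchramm1996, Conj. 4 / Question 3] [cite: ConwaySloane1999, Ch. 4 §7.1]
-/

noncomputable section

namespace Summit.CriticalPhenomena.PercolationContinuityZ3.Theorems.Transplant

namespace Bcc111

open Literature.Probability.Percolation Literature.Probability.LatticeModels SimpleGraph
open scoped Classical

variable {m : ℕ}

/-- **THE bcc (111)-FILMS AT THEIR OWN CRITICAL POINT, EVERY THICKNESS `m ≥ 1`: `θ_{F_m(bcc)}(v, p_c(F_m(bcc))) = 0` for every vertex `v`** — UNCONDITIONAL and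
p205010-free (`m ≤ 2`: injective shadow; `m = 3, 4`: kernel swap-pair certificates; `m ≥ 5`: the elevator-hub certificate).  The Benjamini–Schramm continuity
conjecture for the whole family of bcc (111)-films, by the Duminil-Copin–Sidoravicius–Tassion transplant «HexShadow*».
[cite: DuminilCopinSidoraviciusTassion2016, Thm. 1 and §2] [cite: BenjaminiSchramm1996, Conj. 4 / Question 3] [cite: ConwaySloane1999, Ch. 4 §7.1] -/
theorem theta_criticalProb_eq_zero_of_one_le (hm : 1 ≤ m) (v : bfilm m) : theta (film m) v (criticalProbIOf (film m) v) = 0 := by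
  rcases Nat.lt_or_ge m 3 with h3 | h3
  · exact theta_criticalProb_eq_zero_of_le_two hm (by omega) v
  rcases Nat.lt_or_ge m 5 with h5 | h5
  · interval_cases m
    · exact theta_criticalProb_eq_zero_m3 v
    · exact theta_criticalProb_eq_zero_m4 v
  · exact theta_criticalProb_eq_zero_of_five_le h5 v

/-- **The family form**: every bcc (111)-film of thickness `m ≥ 1` has no infinite cluster at its own critical point, at every vertex. [cite: DuminilCopinSidoraviciusTassion2016, Thm. 1] [cite: BenjaminiSchramm1996, Conj. 4 / Question 3] -/
theorem theta_criticalProb_eq_zero_family : ∀ m : ℕ, 1 ≤ m → ∀ v : bfilm m, theta (film m) v (criticalProbIOf (film m) v) = 0 :=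
  fun _ hm v => theta_criticalProb_eq_zero_of_one_le hm v

end Bcc111

end Summit.CriticalPhenomena.PercolationContinuityZ3.Theorems.Transplant

end
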